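import Mathlib
import Summits.NavierStokesRegularity.NavierStokesRegularity.Theorems.TaoLadderRungTwoFlatCaptureHop
import Summits.NavierStokesRegularity.NavierStokesRegularity.Theorems.TaoLadderRungTwoFlatEnvelopeAhead
import HarnessLib

/-!
# THE CAPTURE PHASE IN ONE CALL: clock ∧ envelope ∧ capture at the choice rule for hops `n + 1 ≤ N₀`, from the reference flow of the hop
  (helper for the K_A♭ parent item stmt-NavierStokesRegularity-22987 `FlatGapCertificatesV2`, child 2A `GradedAdiabaticWakeA` of route
  TaoLadderRungTwoFlat; cell harvest/h2-tao-ladder, p1 g25; LADDER §47.5 L1/L3, §50 (`TubeStepClock/Envelope/Capture`), §52)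

`gapData₂On_of_phases` (p727276) takes, for every capture hop `n < N₀`, the triple `TubeStepClockWith ∧ TubeStepEnvelopeWith ∧
TubeStepCaptureWith`. `…CaptureHop` produced the third from the a-priori-free continuity `sup_deviation_of_gradedFlows` against the hop's
reference flow `Z` (exact graded flow from the centre `ζ n` on `[0, c₀]`, `max(1,c_k)|Z_k| ≤ M_Z`): `|S − Z| ≤ D` at every site along every
premise (`dev_of_capturePremise`, the same argument exported). The other two follow from the same deviation: CLOCK — the carrier at good times
is at least `|Z_{i₀,1}(t)| − D`, so the row `(1+σ)(1+ε₀)^{−θ₀} + D ≤ |Z_{i₀,1}(t)|` on the window feeds `tubeStepClockWith_of_carrier`;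
ENVELOPE — `F ≤ ½S² ≤ ½(|Z| + D)²` on the shells `k ≤ k_H + 1` (rows `½(|Z_k(s)| + D)² ≤ env₀ k` along the reference), and the cut
schedule of `…AheadCuts` beyond (`envelopeAhead_of_cuts`, rows `2G(m−1)² ≤ env₀ m`).

* `dev_of_capturePremise` — `|S − Z|(s) ≤ D` on `[0, c₀]` at every site along every premise of a capture hop;
* `tubeStepClockWith_of_continuity`, `tubeStepEnvelopeWith_of_continuity`;
* `captureHop_of_continuity` — **the triple `clock ∧ envelope ∧ capture` of a capture hop in one call** (the `hcapture n` input of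
  `gapData₂On_of_phases`).

HONEST FRAMING: composition over the cell's typed induction frame (MODEL lattice, graded mirror table on `S♭`); the reference flows, their
bounds and the rows are HYPOTHESES; nothing certified; no item closed; nothing about the Navier–Stokes equations.
-/

noncomputable section

-- the sub-problem namespace repeats the summit name by design (D-0017)
set_option linter.dupNamespace false

namespace Summit.NavierStokesRegularity.NavierStokesRegularity.Theorems.HopTube

open Set Finset Literature.Analysis.FluidPDE Literature.Analysis.FluidPDE.TaoCascade MirrorPulse RenormFrame QuadPolar
  GappedFrontRobustOn

section CapturePhase

variable {ε ε₀ : ℝ}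

/-- **The deviation along every premise of a capture hop**: `|S_{ik}(s) − Z_{ik}(s)| ≤ D` on `[0, c₀]` (reference flow `Z` from the
centre `ζ n`, `max(1,c)|Z| ≤ M_Z`, `B = 5r/4 + c_{k₁}η n`, `B·e^{Lc₀} ≤ D ≤ ½`).
[cite: Tao2016AveragedNS, §5 (continuity argument), §6.3–6.4 (statement shape); route TaoLadderRungTwoFlat, capture hops (cell LADDER §47.5 L3, §50)] -/
theorem dev_of_capturePremise (P : TubeSchedule) {Bcl : ℕ → (Fin 2 → ℤ → ℝ) → Prop} {i₀ : Fin 2}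
    {X₀ : Fin 2 → ℝ} {w : ℤ → ℝ} {r c₀ : ℝ} {ζ : ℕ → Fin 2 → ℤ → ℝ} {ustar : Fin 2 → ℤ → ℝ}
    {n : ℕ} {Z FZ : Fin 2 → ℤ → ℝ → ℝ}
    (hε₀ : 0 < ε₀) (hn : n ≤ P.N₀) (hc₀ : 0 < c₀)
    (hζ0 : ζ 0 = datumState i₀ X₀) (hη0 : 0 ≤ P.η 0) (hηn : 0 ≤ P.η n) (hk₁ : 1 ≤ P.k₁) (hr0 : 0 ≤ r)
    (hw1 : ∀ k, 1 ≤ w k) (hwc : ∀ k : ℤ, 0 ≤ k → clockW ε₀ k ≤ w k)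
    (hZ : PseudoFlowOnShift shiftSetFlat c₀ ε₀ (mirrorTable ε ε) 0 0 (ζ n) (fun i k => (1 / 2) * ζ n i k ^ 2)
      (fun _ _ => 0) Z FZ)
    {MZ B D : ℝ} (hMZ : 0 ≤ MZ) (hZb : ∀ i k, ∀ t ∈ Icc 0 c₀, max 1 (clockW ε₀ k) * |Z i k t| ≤ MZ)
    (hζA : AheadClause P w r (ζ n))
    (hB : 5 / 4 * r + clockW ε₀ P.k₁ * P.η n ≤ B)
    (hD : B * Real.exp (2 * tableAbsSum shiftSetFlat (renormTable ε₀ (mirrorTable ε ε)) * (MZ + 1)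
      * (1 + ε₀) ^ ((5 : ℝ) / 2) * c₀) ≤ D)
    (hDhalf : D ≤ 1 / 2) :
    ∀ z S₀ τ S F, HopPremiseWith P Bcl shiftSetFlat ε₀ i₀ (mirrorTable ε ε) X₀ w r c₀ ζ ustar n z S₀ τ S F →
      ∀ (i : Fin 2) (k : ℤ), ∀ s ∈ Icc 0 c₀, |S i k s - Z i k s| ≤ D := by
  have hε' : (-1 : ℝ) < ε₀ := by linarith
  have hc : ∀ k, 0 < clockW ε₀ k := clockW_pos hε'
  have hZc : ∀ i k, ∀ t ∈ Icc 0 c₀, clockW ε₀ k * |Z i k t| ≤ MZ := fun i k t ht =>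
    (mul_le_mul_of_nonneg_right (le_max_right 1 _) (abs_nonneg _)).trans (hZb i k t ht)
  have hB0 : 0 ≤ B := by
    have := mul_nonneg (hc P.k₁).le hηn
    linarith
  have hT0 : 0 ≤ tableAbsSum shiftSetFlat (renormTable ε₀ (mirrorTable ε ε)) := tableAbsSum_nonneg _ _
  have hL0 : 0 ≤ 2 * tableAbsSum shiftSetFlat (renormTable ε₀ (mirrorTable ε ε)) * (MZ + 1) * (1 + ε₀) ^ ((5 : ℝ) / 2) := by
    have : 0 ≤ (1 + ε₀) ^ ((5 : ℝ) / 2) := Real.rpow_nonneg (by linarith) _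
    positivity
  intro z S₀ τ S F hprem i k s hs
  obtain ⟨hz, hkick, hc₀τ, hflow⟩ := hprem
  obtain ⟨hcap, hA⟩ := capture_of_inTubeWith_le P hn hζ0 hη0 hk₁ hr0 hz
  have hB' := captureStart_le P hε₀.le hcap hA hζA hkick hw1 hwc hr0 hηn hB
  have hS' := pseudoFlowOnShift_mono hflow hc₀ hc₀τ
  have h := sup_deviation_of_gradedFlows hZ hS' hε₀ hc₀.le hMZ hZc hB' (hD.trans hDhalf) i k s hs
  have hmono : B * Real.exp (2 * tableAbsSum shiftSetFlat (renormTable ε₀ (mirrorTable ε ε)) * (MZ + 1)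
      * (1 + ε₀) ^ ((5 : ℝ) / 2) * s) ≤ D :=
    (mul_le_mul_of_nonneg_left (Real.exp_le_exp.mpr (mul_le_mul_of_nonneg_left hs.2 hL0)) hB0).trans hD
  exact ((le_mul_of_one_le_left (abs_nonneg _) (le_max_left 1 _)).trans h).trans hmono

/-- **CLOCK at a capture hop from the deviation**: the row `(1+σ)·(1+ε₀)^{−θ₀} + D ≤ |Z_{i₀,1}(t)|` on the clock window and `1 + σ ≤ A_*`
give `TubeStepClockWith` (via `tubeStepClockWith_of_carrier`). [cite: Tao2016AveragedNS, §6.4 Prop. 6.5 (statement shape); cell TRANSFER-CONSTANTS §4, LADDER §50] -/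
theorem tubeStepClockWith_of_continuity (P : TubeSchedule) {Bcl : ℕ → (Fin 2 → ℤ → ℝ) → Prop} {σ : ℝ} {i₀ : Fin 2}
    {X₀ : Fin 2 → ℝ} {w : ℤ → ℝ} {r θ₀ c₀ t₀ : ℝ} {ζ : ℕ → Fin 2 → ℤ → ℝ} {ustar : Fin 2 → ℤ → ℝ}
    {good : ℕ → (Fin 2 → ℤ → ℝ → ℝ) → ℝ → Prop} {n : ℕ} {Z : Fin 2 → ℤ → ℝ → ℝ} {D : ℝ}
    (hε₀ : 0 < ε₀) (hσ : 0 ≤ σ) (hσA : 1 + σ ≤ P.Astar)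
    (hdev : ∀ z S₀ τ S F, HopPremiseWith P Bcl shiftSetFlat ε₀ i₀ (mirrorTable ε ε) X₀ w r c₀ ζ ustar n z S₀ τ S F →
      ∀ (i : Fin 2) (k : ℤ), ∀ s ∈ Icc 0 c₀, |S i k s - Z i k s| ≤ D)
    {tlo : ℝ} (htlo : 0 < tlo)
    (hex : ∀ z S₀ τ S F, HopPremiseWith P Bcl shiftSetFlat ε₀ i₀ (mirrorTable ε ε) X₀ w r c₀ ζ ustar n z S₀ τ S F →
      ∃ t, good n S t)
    (hwin : ∀ z S₀ τ S F, HopPremiseWith P Bcl shiftSetFlat ε₀ i₀ (mirrorTable ε ε) X₀ w r c₀ ζ ustar n z S₀ τ S F →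
      ∀ t, good n S t → tlo ≤ t ∧ t ≤ c₀)
    (hrefC : ∀ t ∈ Icc tlo c₀, (1 + σ) * (1 + ε₀) ^ (-θ₀) + D ≤ |Z i₀ 1 t|) :
    TubeStepClockWith P Bcl (choiceRule P i₀ ε₀ θ₀ t₀ good) shiftSetFlat σ ε₀ i₀ (mirrorTable ε ε) X₀ w r θ₀ c₀ ζ ustar n := by
  have hε' : (-1 : ℝ) < ε₀ := by linarith
  refine tubeStepClockWith_of_carrier P hε' hσ hσA hex
    (fun z S₀ τ S F h t ht => ⟨htlo.trans_le (hwin z S₀ τ S F h t ht).1, (hwin z S₀ τ S F h t ht).2⟩)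
    fun z S₀ τ S F h t ht => ?_
  obtain ⟨h1, h2⟩ := hwin z S₀ τ S F h t ht
  have hd := hdev z S₀ τ S F h i₀ 1 t ⟨htlo.le.trans h1, h2⟩
  have := abs_sub_abs_le_abs_sub (Z i₀ 1 t) (S i₀ 1 t)
  rw [abs_sub_comm] at hd
  linarith [hrefC t ⟨h1, h2⟩]

/-- **ENVELOPE at a capture hop from the deviation**: `F ≤ ½S² ≤ ½(|Z| + D)²` on `k ≤ k_H + 1` (rows `½(|Z_k(s)| + D)² ≤ env₀ k` along the
reference) and the cut schedule beyond. [cite: Tao2016AveragedNS, §6.2 Prop. 6.3 (ix), §6.4 Prop. 6.5 (iv) (statement shape); cell LADDER §50.8–50.9, §62] -/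
theorem tubeStepEnvelopeWith_of_continuity (P : TubeSchedule) {Bcl : ℕ → (Fin 2 → ℤ → ℝ) → Prop} {i₀ : Fin 2}
    {X₀ : Fin 2 → ℝ} {w : ℤ → ℝ} {r θ₀ c₀ t₀ : ℝ} {ζ : ℕ → Fin 2 → ℤ → ℝ} {ustar : Fin 2 → ℤ → ℝ}
    {good : ℕ → (Fin 2 → ℤ → ℝ → ℝ) → ℝ → Prop} {n : ℕ} {Z : Fin 2 → ℤ → ℝ → ℝ} {D : ℝ}
    (hε : 0 ≤ ε) (hε₀ : 0 < ε₀) (hn : n ≤ P.N₀) (hc₀ : 0 < c₀)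
    (hζ0 : ζ 0 = datumState i₀ X₀) (hη0 : 0 ≤ P.η 0) (hk₁ : 1 ≤ P.k₁) (hr0 : 0 ≤ r) (hw1 : ∀ k, 1 ≤ w k)
    (hdev : ∀ z S₀ τ S F, HopPremiseWith P Bcl shiftSetFlat ε₀ i₀ (mirrorTable ε ε) X₀ w r c₀ ζ ustar n z S₀ τ S F →
      ∀ (i : Fin 2) (k : ℤ), ∀ s ∈ Icc 0 c₀, |S i k s - Z i k s| ≤ D)
    {tlo : ℝ}
    (hex : ∀ z S₀ τ S F, HopPremiseWith P Bcl shiftSetFlat ε₀ i₀ (mirrorTable ε ε) X₀ w r c₀ ζ ustar n z S₀ τ S F →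
      ∃ t, good n S t)
    (hwin : ∀ z S₀ τ S F, HopPremiseWith P Bcl shiftSetFlat ε₀ i₀ (mirrorTable ε ε) X₀ w r c₀ ζ ustar n z S₀ τ S F →
      ∀ t, good n S t → tlo ≤ t ∧ t ≤ c₀)
    -- rows: reference hull + D against the envelope on `k ≤ k_H + 1`; the cut schedule beyond
    {env₀ : ℤ → ℝ} {kH : ℤ} {Vtop : ℝ} {G Ω : ℤ → ℝ} (hk₁H : (P.k₁ : ℤ) ≤ kH + 2) (hVtop : 0 ≤ Vtop)
    (hG0 : ∀ j, kH < j → 0 ≤ G j)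
    (hrefE : ∀ s ∈ Icc 0 c₀, ∀ (i : Fin 2) (k : ℤ), k ≤ kH + 1 → (1 / 2) * (|Z i k s| + D) ^ 2 ≤ env₀ k)
    (hrefV : ∀ t ∈ Icc 0 c₀, |Z 1 (kH + 1) t| + D ≤ Vtop)
    (hΩ : ∀ j, kH < j → ∀ N : Finset ℤ, (∀ m ∈ N, j < m) → ∑ m ∈ N, (w m)⁻¹ ^ 2 ≤ Ω j)
    (hGΩ : ∀ j, kH < j → 2 * (9 / 8 * r) ^ 2 * Ω j ≤ G j ^ 2)
    (hclose0 : 4 / 3 * c₀ * clock ε₀ (kH + 1) * Vtop * (Vtop + 2 * ε * G (kH + 1)) < G (kH + 1))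
    (hcloseG : ∀ j, kH + 1 ≤ j →
      4 / 3 * c₀ * clock ε₀ (j + 1) * (2 * G j) * (2 * G j + 2 * ε * G (j + 1)) < G (j + 1))
    (henvA : ∀ m : ℤ, kH + 1 < m → 2 * G (m - 1) ^ 2 ≤ env₀ m) :
    TubeStepEnvelopeWith P Bcl (choiceRule P i₀ ε₀ θ₀ t₀ good) shiftSetFlat ε₀ i₀ (mirrorTable ε ε) X₀ w r c₀ env₀ ζ
      ustar n := by
  have hw0 : ∀ k, 0 < w k := fun k => lt_of_lt_of_le one_pos (hw1 k)
  -- ahead: the cut schedule (window-top hull read off the reference, initial tails from the capture premise)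
  have hVt : ∀ z S₀ τ S F, HopPremiseWith P Bcl shiftSetFlat ε₀ i₀ (mirrorTable ε ε) X₀ w r c₀ ζ ustar n z S₀ τ S F →
      ∀ t ∈ Icc 0 c₀, |S 1 (kH + 1) t| ≤ Vtop := by
    intro z S₀ τ S F hprem t ht
    have hd := hdev z S₀ τ S F hprem 1 (kH + 1) t ht
    have := abs_sub_abs_le_abs_sub (S 1 (kH + 1) t) (Z 1 (kH + 1) t)
    linarith [hrefV t ht]
  have hinit : ∀ j, kH < j → ∀ z S₀ τ S F,
      HopPremiseWith P Bcl shiftSetFlat ε₀ i₀ (mirrorTable ε ε) X₀ w r c₀ ζ ustar n z S₀ τ S F →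
        ∀ N : Finset ℤ, (∀ m ∈ N, j < m) → ∑ m ∈ N, ∑ i : Fin 2, S₀ i m ^ 2 ≤ G j ^ 2 := by
    intro j hj z S₀ τ S F hprem N hN
    obtain ⟨hz, hkick, -, -⟩ := hprem
    obtain ⟨-, hA⟩ := capture_of_inTubeWith_le P hn hζ0 hη0 hk₁ hr0 hz
    exact (initialTail_le_of_clauses P hw0 hr0 hA hkick (by omega) hN (hΩ j hj N hN)).trans (hGΩ j hj)
  have hcuts := aheadCuts_of_schedule (P := P) (Bcl := Bcl) (i₀ := i₀) (X₀ := X₀) (w := w) (r := r) (ζ := ζ) (ustar := ustar)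
    (n := n) hε hε₀ hc₀.le hVtop hG0 hVt hinit hclose0 hcloseG
  have hahead := envelopeAhead_of_cuts (env₀ := env₀) hcuts henvA
  intro z S₀ τ S F hprem s hs
  have hgood := chooseTime_spec (t₀ := t₀) (hex z S₀ τ S F hprem)
  simp only [choiceRule_τ₁] at hs
  obtain ⟨-, htc₀⟩ := hwin z S₀ τ S F hprem _ hgood
  have hsc : s ∈ Icc 0 c₀ := ⟨hs.1, hs.2.trans htc₀⟩
  have hF : ∀ (i : Fin 2) (k : ℤ), F i k s ≤ (1 / 2) * S i k s ^ 2 := by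
    obtain ⟨-, -, hc₀τ, hflow⟩ := hprem
    exact fun i k => energy_le_half_sq_of_premiseFlow hflow ⟨hs.1, hsc.2.trans hc₀τ⟩ i k
  intro i k
  rcases le_or_gt k (kH + 1) with hk | hk
  · have hd := hdev z S₀ τ S F hprem i k s hsc
    have hS : |S i k s| ≤ |Z i k s| + D := by
      have := abs_sub_abs_le_abs_sub (S i k s) (Z i k s); linarith
    have h0 : 0 ≤ |Z i k s| + D := (abs_nonneg _).trans hS
    have hsq : S i k s ^ 2 ≤ (|Z i k s| + D) ^ 2 := by
      rw [← sq_abs]; exact pow_le_pow_left₀ (abs_nonneg _) hS 2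
    calc F i k s ≤ (1 / 2) * S i k s ^ 2 := hF i k
      _ ≤ (1 / 2) * (|Z i k s| + D) ^ 2 := by linarith
      _ ≤ env₀ k := hrefE s hsc i k hk
  · exact hahead z S₀ τ S F hprem s hsc i k hk

/-- **THE CAPTURE HOP IN ONE CALL**: `TubeStepClockWith ∧ TubeStepEnvelopeWith ∧ TubeStepCaptureWith` of any slot at the choice rule, hop
`n + 1 ≤ N₀`, from the reference flow of the hop and scalar rows (the `hcapture n` input of `gapData₂On_of_phases`).
[cite: Tao2016AveragedNS, §5, §6.2 Prop. 6.3 (ix), §6.3–6.4 Props. 6.4–6.5 (statement shape); route TaoLadderRungTwoFlat, capture phase (cell LADDER §47.5, §50, §52)] -/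
theorem captureHop_of_continuity (P : TubeSchedule) {Bcl : ℕ → (Fin 2 → ℤ → ℝ) → Prop} {σ : ℝ} {i₀ : Fin 2}
    {X₀ : Fin 2 → ℝ} {w : ℤ → ℝ} {r θ₀ c₀ t₀ : ℝ} {ζ : ℕ → Fin 2 → ℤ → ℝ} {ustar : Fin 2 → ℤ → ℝ}
    {good : ℕ → (Fin 2 → ℤ → ℝ → ℝ) → ℝ → Prop} {n : ℕ} {Z FZ : Fin 2 → ℤ → ℝ → ℝ}
    (hε : 0 ≤ ε) (hε₀ : 0 < ε₀) (hn : n + 1 ≤ P.N₀) (hc₀ : 0 < c₀)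
    (hζ0 : ζ 0 = datumState i₀ X₀) (hη0 : 0 ≤ P.η 0) (hηn : 0 ≤ P.η n) (hk₁ : 1 ≤ P.k₁) (hr0 : 0 ≤ r)
    (hw1 : ∀ k, 1 ≤ w k) (hwc : ∀ k : ℤ, 0 ≤ k → clockW ε₀ k ≤ w k) (hAstar : 0 < P.Astar)
    (hθ₀ : 0 ≤ θ₀) (hθ₀1 : θ₀ ≤ 1) (hAFL : 0 < 1 - θ₀ * ε₀) (hσ : 0 ≤ σ) (hσA : 1 + σ ≤ P.Astar)
    -- the reference flow of the hop
    (hZ : PseudoFlowOnShift shiftSetFlat c₀ ε₀ (mirrorTable ε ε) 0 0 (ζ n) (fun i k => (1 / 2) * ζ n i k ^ 2)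
      (fun _ _ => 0) Z FZ)
    {MZ B D : ℝ} (hMZ : 0 ≤ MZ) (hZb : ∀ i k, ∀ t ∈ Icc 0 c₀, max 1 (clockW ε₀ k) * |Z i k t| ≤ MZ)
    (hζA : AheadClause P w r (ζ n))
    (hB : 5 / 4 * r + clockW ε₀ P.k₁ * P.η n ≤ B)
    (hD : B * Real.exp (2 * tableAbsSum shiftSetFlat (renormTable ε₀ (mirrorTable ε ε)) * (MZ + 1)
      * (1 + ε₀) ^ ((5 : ℝ) / 2) * c₀) ≤ D)
    (hDhalf : D ≤ 1 / 2)
    -- good section times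
    {tlo : ℝ} (htlo : 0 < tlo)
    (hex : ∀ z S₀ τ S F, HopPremiseWith P Bcl shiftSetFlat ε₀ i₀ (mirrorTable ε ε) X₀ w r c₀ ζ ustar n z S₀ τ S F →
      ∃ t, good n S t)
    (hwin : ∀ z S₀ τ S F, HopPremiseWith P Bcl shiftSetFlat ε₀ i₀ (mirrorTable ε ε) X₀ w r c₀ ζ ustar n z S₀ τ S F →
      ∀ t, good n S t → tlo ≤ t ∧ t ≤ c₀)
    -- rows along the reference: carrier, capture, envelope hull, ahead window/hull; budgets; cut schedule
    {ρ : ℝ} {env₀ : ℤ → ℝ} {kH : ℤ} {Vtop : ℝ} {G Ω : ℤ → ℝ}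
    (hrefC : ∀ t ∈ Icc tlo c₀, (1 + σ) * (1 + ε₀) ^ (-θ₀) + D ≤ |Z i₀ 1 t|)
    (href : ∀ t ∈ Icc tlo c₀, ∀ (i : Fin 2) (k : ℤ),
      |Z i (1 + k) t / clampedRatio P i₀ ε₀ θ₀ t Z - ζ (n + 1) i k| ≤ ρ)
    (hbudget : D * (1 / (1 + ε₀) ^ (-θ₀) + MZ / (P.Astar * ((1 + ε₀) ^ (-θ₀)) ^ 2)) + ρ ≤ P.η (n + 1))
    (hk₁H : (P.k₁ : ℤ) ≤ kH + 2) (hVtop : 0 ≤ Vtop) (hG0 : ∀ j, kH < j → 0 ≤ G j)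
    (hrefE : ∀ s ∈ Icc 0 c₀, ∀ (i : Fin 2) (k : ℤ), k ≤ kH + 1 → (1 / 2) * (|Z i k s| + D) ^ 2 ≤ env₀ k)
    (hrefA : ∀ t ∈ Icc tlo c₀, ∀ (i : Fin 2) (k : ℤ), (P.k₁ : ℤ) ≤ k → k ≤ kH →
      8 * (w k * (|Z i (1 + k) t| + D)) ≤ r * (1 - θ₀ * ε₀))
    (hrefV : ∀ t ∈ Icc 0 c₀, |Z 1 (kH + 1) t| + D ≤ Vtop)
    (hΩ : ∀ j, kH < j → ∀ N : Finset ℤ, (∀ m ∈ N, j < m) → ∑ m ∈ N, (w m)⁻¹ ^ 2 ≤ Ω j)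
    (hGΩ : ∀ j, kH < j → 2 * (9 / 8 * r) ^ 2 * Ω j ≤ G j ^ 2)
    (hclose0 : 4 / 3 * c₀ * clock ε₀ (kH + 1) * Vtop * (Vtop + 2 * ε * G (kH + 1)) < G (kH + 1))
    (hcloseG : ∀ j, kH + 1 ≤ j →
      4 / 3 * c₀ * clock ε₀ (j + 1) * (2 * G j) * (2 * G j + 2 * ε * G (j + 1)) < G (j + 1))
    (hGr : ∀ k, kH < k → 8 * (w k * (2 * G k)) ≤ r * (1 - θ₀ * ε₀))
    (henvA : ∀ m : ℤ, kH + 1 < m → 2 * G (m - 1) ^ 2 ≤ env₀ m) :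
    TubeStepClockWith P Bcl (choiceRule P i₀ ε₀ θ₀ t₀ good) shiftSetFlat σ ε₀ i₀ (mirrorTable ε ε) X₀ w r θ₀ c₀ ζ ustar n ∧
      TubeStepEnvelopeWith P Bcl (choiceRule P i₀ ε₀ θ₀ t₀ good) shiftSetFlat ε₀ i₀ (mirrorTable ε ε) X₀ w r c₀ env₀ ζ
        ustar n ∧
      TubeStepCaptureWith P Bcl (choiceRule P i₀ ε₀ θ₀ t₀ good) shiftSetFlat ε₀ i₀ (mirrorTable ε ε) X₀ w r c₀ ζ ustar n := by
  have hdev := dev_of_capturePremise (Bcl := Bcl) (ustar := ustar) P hε₀ (by omega) hc₀ hζ0 hη0 hηn hk₁ hr0 hw1 hwc hZ hMZ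
    hZb hζA hB hD hDhalf
  exact ⟨tubeStepClockWith_of_continuity P hε₀ hσ hσA hdev htlo hex hwin hrefC,
    tubeStepEnvelopeWith_of_continuity P hε hε₀ (by omega) hc₀ hζ0 hη0 hk₁ hr0 hw1 hdev hex hwin hk₁H hVtop hG0 hrefE
      hrefV hΩ hGΩ hclose0 hcloseG henvA,
    tubeStepCaptureWith_of_continuity P hε hε₀ hn hc₀ hζ0 hη0 hηn hk₁ hr0 hw1 hwc hAstar hθ₀ hθ₀1 hAFL hZ hMZ hZb hζA hB hD
      hDhalf htlo hex hwin href hbudget hk₁H hVtop hG0 hrefA hrefV hΩ hGΩ hclose0 hcloseG hGr⟩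

end CapturePhase

end Summit.NavierStokesRegularity.NavierStokesRegularity.Theorems.HopTube

end
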